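import Summits.HodgeConjecture.Statement
import Summits.HodgeConjecture.HodgeConjecture.Theses.RankFourFaces
import Summits.HodgeConjecture.HodgeConjecture.Theses.PadicSemiregularLift
import Literature.AlgebraicGeometry.HodgeTheory.HodgeGroupProductCMFactorClasses
import HarnessLib

/-!
# Ring 2 · route `motiv` (generation 2) — the CM-factor product theorem: closed classes by name and EXACTNESS (`HC_CM ⟺` the Hodge conjecture on every admissible slice `{A₀ × C : C of CM type}`)

HONEST FRAMING: research route conditional on HC_CM; not a corollary; Q11.4-sentence-2 already refuted in dim ≥ 3.

Cell `pub-hodge-ring2`, seat `pub-hodge-ring2-motiv-g2`. SUMMIT-SIDE binding of the Literature file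
`Literature/AlgebraicGeometry/HodgeTheory/HodgeGroupProductCMFactorClasses.lean` (sequel to
`Theorems/Ring2MotivProductCMFactor.lean`, p188311): the hypothesis "Hodge conjecture for complex abelian
varieties of CM type" is bound BY NAME to the tree's route item `Theses.RankFourFaces.CMAbelianHodge`
(stmt-HodgeConjecture-3052; it is `∀ B, Milne1999.CMHodgeHypothesisAt B` by `Iff.rfl`). `HC_CM` is a
HYPOTHESIS (a binder) of every conditional theorem — never an axiom, never "known". `HC_AV` is the tree
item `Theses.PadicSemiregularLift.HodgeAbelianVarieties` (stmt-HodgeConjecture-1333). The printed input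
`Hg(A × C) = Hg(A) × Hg(C)` for `A` without simple factor of type IV and `C` of CM type (Lombardo 2016,
Lemma 3.4; Moonen–Zarhin 1999, §3 (3.1)) enters as the named fact `Lombardo2016_hodgeClassesProductSpan`
(binder `hL`). No transport / deformation / semiregularity is used: the Q11.4 no-go does not bear.

## Content (one-line compositions of the Literature theorems; sorry-free)

Closed classes (conditional on `HC_CM`, `hL`):
* `hodgeConjectureFor_prod_of_cmAbelianHodge_of_isDivisorGenerated` — `A` with `B(A) = D(A)`
  (`IsDivisorGenerated A`: every rational `(p,p)`-class is a polynomial in divisor classes; van Geemen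
  LNM 1594 §2.4) and no type-IV factor, `C` of CM type ⟹ HC(`A × C`). HC(`A`) is PROVED from `B = D`
  (Lefschetz `(1,1)` is a tree theorem), so the only conjectural input is `HC_CM` at `C`.
* `hodgeConjectureFor_powSucc_prod_of_cmAbelianHodge_of_tankeevRibet` — `X^{N+1} × C`, `X` simple of
  prime dimension (Tankeev 1982 / Ribet 1983 = Moonen–Zarhin 1999 Thm. (2.7), the named fact
  `TankeevRibet1983_hodgeClasses_divisorial_powers_simplePrimeDimension`, binder `hT`), the power without
  type-IV factor (explicit), `C` of CM type.
* `hodgeConjectureFor_prod_cmProd_of_cmAbelianHodge` (+ `_of_dim_le_three`) — ONE CM BLOCK of length two,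
  `A × (C₁ × C₂)`, honestly: `C₁ × C₂` is of CM type by the tree THEOREM `Milne1999.CMTypeProducts.isOfCMType_prod`.

Exactness:
* (Literature, reused not restated: `HodgeTheory.hodgeConjectureFor_prod_iff_of_lombardo` — for `A`
  without type-IV factor and `C` of CM type, HC(`A × C`) ⟺ HC(`A`) ∧ HC(`C`); and the unconditional slices
  `HodgeTheory.hodgeConjectureFor_left_of_prod` / `…_right_of_prod`, Fulton §19.2 / §10.1.)
* `cmAbelianHodge_iff_forall_prod_cmType` — for ANY ONE `A₀` without type-IV factor satisfying HC
  (`_of_dim_le_three`: e.g. `dim A₀ ≤ 3`), `HC_CM ⟺ (∀ C of CM type, HC(A₀ × C))`, modulo `hL` (used for `⟹`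
  only). So on the class this route reaches, `HC_CM` is EXACTLY the missing input: necessary
  (`cmAbelianHodge_of_forall_sq`, unconditional) and sufficient.
* ON-PATH: `…_of_hodgeConjecture`, `…_of_hodgeAbelianVarieties`, `cmAbelianHodge_of_hodgeAbelianVarieties`
  — every conclusion is an instance of the summit statement / of `HC_AV`.

What is NOT reached (cell RING2-MAP.md §motiv): products whose non-CM factor has a type-IV simple factor
sharing its centre with the CM factor (Hodge group does not split; Shioda), simple non-CM abelian
varieties of Weil type, and Abdulali's domination classes (their input is the usual HC on NON-split
products `A × B × C`, not `HC_CM`).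

References: Lombardo2016 (Lemma 3.4 p. 1229 = Lemma 35 of arXiv:1402.1478); MoonenZarhin1999LowDim (§3 (3.1),
Thm. (2.7)); vanGeemen1994HodgeAV (§2.4, Thms. 4.3, 4.6); Milne1999 (§7 (H)); Fulton1998 (§19.2, §10.1);
Abdulali2016TateTwists (§3, §6).
-/

set_option linter.dupNamespace false

namespace Summit.HodgeConjecture.HodgeConjecture.Ring2.Motiv

open Literature.AlgebraicGeometry Literature.AlgebraicGeometry.Motives
open Literature.AlgebraicGeometry.HodgeTheory Literature.AlgebraicTopology.SingularHomology
open Summit.HodgeConjecture.HodgeConjecture.Theses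

/-! ## Closed classes, conditional on `HC_CM` (binder) -/

/-- **`B(A) = D(A)`, no type IV, `C` of CM type ⟹ HC(`A × C`), granted `HC_CM`.** `HC_CM` (tree item
`RankFourFaces.CMAbelianHodge`, a HYPOTHESIS) is used exactly once, for HC(`C`); HC(`A`) is proved from
`IsDivisorGenerated A` (van Geemen §2.4 "if `Dᵖ = Bᵖ` then the Hodge `(p,p)`-conjecture is true",
the Literature theorem `hodgeConjectureFor_of_isDivisorGenerated`). [cite: vanGeemen1994HodgeAV, §2.4]
[cite: Lombardo2016, Lemma 3.4 (p. 1229; = Lemma 35 of arXiv:1402.1478)] -/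
theorem hodgeConjectureFor_prod_of_cmAbelianHodge_of_isDivisorGenerated
    (hCM : RankFourFaces.CMAbelianHodge) (hL : Lombardo2016_hodgeClassesProductSpan)
    (A C : AbelianVariety ℂ) (hA4 : HasNoTypeIVFactor A) (hCt : Milne1999.IsOfCMType C)
    (hD : IsDivisorGenerated A) :
    HodgeConjectureFor (A.prod C).dim (A.prod C).X :=
  hodgeConjectureFor_prod_of_cmHodgeHypothesis_of_isDivisorGenerated hCM hL A C hA4 hCt hD

/-- **Powers of simple abelian varieties of prime dimension times a CM factor, granted `HC_CM` and
Tankeev–Ribet.** For `X` simple of prime dimension `p`, any `N`, `C` of CM type, and `X^{N+1}` without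
type-IV factor (explicit hypothesis `h4`): HC(`X^{N+1} × C`). [cite: MoonenZarhin1999LowDim, §2 Thm. (2.7) and §3 (3.1)] -/
theorem hodgeConjectureFor_powSucc_prod_of_cmAbelianHodge_of_tankeevRibet
    (hCM : RankFourFaces.CMAbelianHodge) (hL : Lombardo2016_hodgeClassesProductSpan)
    (hT : TankeevRibet1983_hodgeClasses_divisorial_powers_simplePrimeDimension)
    (X : AbelianVariety ℂ) {p : ℕ} (hp : p.Prime) (hX : X.dim = p) (hs : X.IsSimple) (N : ℕ)
    (C : AbelianVariety ℂ) (h4 : HasNoTypeIVFactor (X.powSucc N)) (hCt : Milne1999.IsOfCMType C) :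
    HodgeConjectureFor ((X.powSucc N).prod C).dim ((X.powSucc N).prod C).X :=
  hodgeConjectureFor_powSucc_prod_of_cmHodgeHypothesis_of_tankeevRibet hCM hL hT X hp hX hs N C h4 hCt

/-- **One CM block of length two: HC(`A × (C₁ × C₂)`), granted `HC_CM`**, for `A` without type-IV factor
satisfying HC and `C₁`, `C₂` of CM type of positive dimension (`C₁ × C₂` is of CM type by the tree
theorem `Milne1999.CMTypeProducts.isOfCMType_prod`). [cite: Milne1999, §1 (products of CM abelian varieties are CM)]
[cite: Lombardo2016, Lemma 3.4 (p. 1229; = Lemma 35 of arXiv:1402.1478)] -/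
theorem hodgeConjectureFor_prod_cmProd_of_cmAbelianHodge
    (hCM : RankFourFaces.CMAbelianHodge) (hL : Lombardo2016_hodgeClassesProductSpan)
    (A C₁ C₂ : AbelianVariety ℂ) (hA4 : HasNoTypeIVFactor A) (hC₁ : Milne1999.IsOfCMType C₁)
    (hC₂ : Milne1999.IsOfCMType C₂) (h₁ : 0 < C₁.dim) (h₂ : 0 < C₂.dim)
    (hA : HodgeConjectureFor A.dim A.X) :
    HodgeConjectureFor (A.prod (C₁.prod C₂)).dim (A.prod (C₁.prod C₂)).X :=
  hodgeConjectureFor_prod_cmProd_of_cmHodgeHypothesis hCM hL A C₁ C₂ hA4 hC₁ hC₂ h₁ h₂ hA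

/-- The CM-block class with `dim A ≤ 3` (refereed inputs only besides the binders `HC_CM`, `hL`).
[cite: MoonenZarhin1999LowDim, Introduction and §3] -/
theorem hodgeConjectureFor_prod_cmProd_of_cmAbelianHodge_of_dim_le_three
    (hCM : RankFourFaces.CMAbelianHodge) (hL : Lombardo2016_hodgeClassesProductSpan)
    (A C₁ C₂ : AbelianVariety ℂ) (hd : A.dim ≤ 3) (hA4 : HasNoTypeIVFactor A)
    (hC₁ : Milne1999.IsOfCMType C₁) (hC₂ : Milne1999.IsOfCMType C₂) (h₁ : 0 < C₁.dim) (h₂ : 0 < C₂.dim) :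
    HodgeConjectureFor (A.prod (C₁.prod C₂)).dim (A.prod (C₁.prod C₂)).X :=
  hodgeConjectureFor_prod_cmProd_of_cmHodgeHypothesis_of_dim_le_three hCM hL A C₁ C₂ hd hA4 hC₁ hC₂ h₁ h₂

/-! ## Exactness: `HC_CM` is necessary and sufficient on the class -/

/-- **`HC_CM` ⟺ the Hodge conjecture on the slice `{A₀ × C : C of CM type}`**, for ANY ONE complex
abelian variety `A₀` without type-IV factor satisfying HC, modulo the span fact (used for `⟹` only; `⟸`
is unconditional). Neither side is asserted. [cite: Milne1999, §7 p. 72]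
[cite: Lombardo2016, Lemma 3.4 (p. 1229; = Lemma 35 of arXiv:1402.1478)] -/
theorem cmAbelianHodge_iff_forall_prod_cmType (hL : Lombardo2016_hodgeClassesProductSpan)
    (A₀ : AbelianVariety ℂ) (h₀4 : HasNoTypeIVFactor A₀) (h₀ : HodgeConjectureFor A₀.dim A₀.X) :
    RankFourFaces.CMAbelianHodge ↔
      ∀ C : AbelianVariety ℂ, Milne1999.IsOfCMType C →
        HodgeConjectureFor (A₀.prod C).dim (A₀.prod C).X :=
  (forall_prod_cmType_iff_cmHodgeHypothesis hL A₀ h₀4 h₀).symm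

/-- The slice equivalence with `dim A₀ ≤ 3` (HC(`A₀`) is the tree theorem
`hodgeConjectureFor_of_dim_le_three_holds`). [cite: MoonenZarhin1999LowDim, Introduction and §3 (3.1)] -/
theorem cmAbelianHodge_iff_forall_prod_cmType_of_dim_le_three
    (hL : Lombardo2016_hodgeClassesProductSpan) (A₀ : AbelianVariety ℂ) (hd : A₀.dim ≤ 3)
    (h₀4 : HasNoTypeIVFactor A₀) :
    RankFourFaces.CMAbelianHodge ↔
      ∀ C : AbelianVariety ℂ, Milne1999.IsOfCMType C →
        HodgeConjectureFor (A₀.prod C).dim (A₀.prod C).X :=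
  (forall_prod_cmType_iff_cmHodgeHypothesis_of_dim_le_three hL A₀ hd h₀4).symm

/-- **Unconditional necessity**: HC for every self-product `C × C` of a CM abelian variety gives `HC_CM`
(no span fact, no type hypothesis). [cite: Fulton1998, §19.2 Cor. 19.2 (b)] -/
theorem cmAbelianHodge_of_forall_sq
    (h : ∀ C : AbelianVariety ℂ, Milne1999.IsOfCMType C →
      HodgeConjectureFor (C.prod C).dim (C.prod C).X) :
    RankFourFaces.CMAbelianHodge :=
  cmHodgeHypothesis_of_forall_sq h

/-! ## On-path lemmas: every conclusion is a consequence of the summit statement / of `HC_AV` -/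

/-- ON-PATH: the summit statement gives the CM-block conclusion outright. [folklore] -/
theorem hodgeConjectureFor_prod_cmProd_of_hodgeConjecture (h : _root_.HodgeConjecture)
    (A C₁ C₂ : AbelianVariety ℂ) :
    HodgeConjectureFor (A.prod (C₁.prod C₂)).dim (A.prod (C₁.prod C₂)).X :=
  HodgeTheory.hodgeConjectureFor_prod_cmProd_of_hodgeConjecture h A C₁ C₂

/-- ON-PATH: the summit statement gives the power-times-CM conclusion outright. [folklore] -/
theorem hodgeConjectureFor_powSucc_prod_of_hodgeConjecture (h : _root_.HodgeConjecture)
    (X : AbelianVariety ℂ) (N : ℕ) (C : AbelianVariety ℂ) :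
    HodgeConjectureFor ((X.powSucc N).prod C).dim ((X.powSucc N).prod C).X :=
  h (AbelianVariety.isSmoothProjective_holds (A := (X.powSucc N).prod C))

/-- ON-PATH: every conclusion is an instance of `HC_AV`. [folklore] -/
theorem hodgeConjectureFor_prod_cmProd_of_hodgeAbelianVarieties
    (hAV : PadicSemiregularLift.HodgeAbelianVarieties) (A C₁ C₂ : AbelianVariety ℂ) :
    HodgeConjectureFor (A.prod (C₁.prod C₂)).dim (A.prod (C₁.prod C₂)).X :=
  hAV (A.prod (C₁.prod C₂))

/-- ON-PATH: `HC_AV ⟹ HC_CM` (forget the CM hypothesis); with the open item `RankFourFaces.CMToAbelian`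
(`HC_CM → HC_AV`, NOT proved here or anywhere) this is the bi-implication the cell is organised around.
[folklore] -/
theorem cmAbelianHodge_of_hodgeAbelianVarieties (hAV : PadicSemiregularLift.HodgeAbelianVarieties) :
    RankFourFaces.CMAbelianHodge :=
  fun A _ _ => hAV A

/-- ON-PATH: the right-hand side of `cmAbelianHodge_iff_forall_prod_cmType` follows from the summit
statement, so the equivalence claims nothing beyond the summit on either side. [folklore] -/
theorem forall_prod_cmType_of_hodgeConjecture (h : _root_.HodgeConjecture) (A₀ : AbelianVariety ℂ) :
    ∀ C : AbelianVariety ℂ, Milne1999.IsOfCMType C →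
      HodgeConjectureFor (A₀.prod C).dim (A₀.prod C).X :=
  HodgeTheory.forall_prod_cmType_of_hodgeConjecture h A₀

end Summit.HodgeConjecture.HodgeConjecture.Ring2.Motiv
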